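import Literature.NumberTheory.EllipticCurves.ComplexMultiplicationShaRubinHomDescentProofs
import Literature.NumberTheory.EllipticCurves.ComplexMultiplicationDeuringFrobeniusProofs
import HarnessLib

/-!
# Route `PrintCFram`, crux C2 `BottomClassIndexLawFiveLe` (stmt-BirchSwinnertonDyer-20372), line
# `eisenstein-resource-bdp-line` (v7 stub S2 `stub_kolyvaginUpper_borelCM`): a CENTRAL HOMOTHETY
# `≢ 1 (mod p)` in the image of `Γ_K` on `E[n]` kills `H¹(K(E[n])/K, E[n])` and `E[n]^{Γ_K}` (Sah);
# lifting a homothety from `E[p]` to `E[p^k]`; the `2 × 2` matrix algebra of the Borel CM prime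
# (cell `bsd-print-cfram`, seat `bsd-line-cfram-p1-w2` g5; helper `--supports` 20372; 0 facts, 0 defs)

HONEST FRAMING. Nothing about BSD is proved here. This is file 1/3 of the width seat's discharge of
the two COHOMOLOGICAL inputs of Kolyvagin's argument at the Borel CM-ramified prime
(Grigorov–Jorza–Patrikis–Stein–Tarniţă 2009, Props. 5.2 and 5.4 — the two places where the tree's
Kolyvagin machine `HeegnerPointsKolyvagin*` consumes `HasSurjectiveModNGaloisRep p` for cohomological
vanishing), GENERIC part:

* §1 `smul_pow_eq_of_smul_eq` — for a monoid `G` acting on an abelian group `A`: if `g` acts on `A[p]`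
  as an integer scalar `d`, then `g^{p^{k-1}}` acts on `A[p^k]` as `d^{p^{k-1}}` (`(d + E)^p = d^p`
  on `A[p^{k+1}]` because `E² = 0` and `pE = 0` there). Elementary; no structure theory of `A[p^k]`.
* §2 `subgroupResKer_torsionFixing_eq_bot_of_smul_eq` — for an elliptic curve `E` over ANY field
  `K` and `n ≥ 1`: if some `g₀ ∈ Γ_K` acts on `E[n]` as an integer scalar `d` with `(d − 1, n) = 1`,
  then `ker (H¹(K, E[n]) → H¹(K(E[n]), E[n])) = 0` (Sah's lemma in the tree's form
  `Rubin1987.subgroupResKer_eq_bot_of_bijOn`: `g₀` is central modulo `Γ_{K(E[n])}` and `g₀ − 1` is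
  bijective), and `eq_zero_of_forall_smul_eq_of_smul_eq` — `E[n]^{Γ_K} = 0`.
* §3 `exists_eq_smul_one_add_smul_of_commute_of_ne` — the commutant of a NON-SCALAR `2 × 2` matrix
  over a field is `F + F·A` (the tree's `DeuringLadic` version needs `tr² ≠ 4 det`, false for a
  nilpotent `A`); `mul_conj_eq_det_smul_one` — for `A ≠ 0`, `A² = 0`, `B` commuting and `C`
  anti-commuting with `A`: `B · (C B C⁻¹) = det B · 1` (with `B = u + vA`: `(u + vA)(u − vA) = u²`).

Files 2/3 (`…BorelHomothetyLevelP`) and 3/3 (`…BorelH1Vanishing`) feed §3 with `A = √−p` on `E[p]`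
(the tree's twist endomorphism of the CM leaf), `B = ρ̄(h)`, `C = ρ̄(c)`, `det ρ̄ = χ̄_p`, and conclude
`H¹(K''(E[p^M])/K'', E[p^M]) = 0` and `E(K'')[p^∞] = 0` for every leaf curve and every quadratic
`K'' ∌ √−p`. THEOREMS ONLY; no definition, no named fact, no `sorry`; imports no `Theses` module.
BSD is not proved by any of this; no summit statement is proved by this seat.
References: [GrigorovJorzaPatrikisSteinTarnita2009] Props. 5.2, 5.4; [Rubin1999] Lemma 6.1–6.2;
[Sah1968] Prop. 2.7 (b); [Serre1972] §1.11.
-/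

set_option autoImplicit false
-- `…BirchSwinnertonDyer.BirchSwinnertonDyer.Theorems…` is the problem's mandated namespace (D-0017).
set_option linter.dupNamespace false

noncomputable section

open scoped Classical Matrix

namespace Summit.BirchSwinnertonDyer.BirchSwinnertonDyer.Theorems.PrintCFram.BorelHomothety

open WeierstrassCurve Field Literature.NumberTheory.EllipticCurves
  Literature.NumberTheory.GaloisRepresentations

universe u

/-! ## §1 Lifting a homothety from `A[p]` to `A[p^k]` -/

section Lift

variable {G A : Type*} [Monoid G] [AddCommGroup A] [DistribMulAction G A]

/-- One step of the lift: if `g` acts as the integer scalar `d` on `A[n]` and `p ∣ n`, then `g^p`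
acts as `d^p` on `A[n p]`. (With `E x = g x - d x`: `E` kills `A[n]`, so on `A[np]` one has
`p E = 0`, `E ∘ E = 0`, `g E = d E`, whence `g^{j+1} x = d^{j+1} x + (j+1) d^j E x` and at
`j + 1 = p` the second term is `d^{p-1} (p E x) = 0`.) [folklore] -/
theorem smul_pow_eq_of_smul_eq_step {p n : ℕ} (hn : p ∣ n) {g : G} {d : ℤ}
    (hg : ∀ x : A, n • x = 0 → g • x = d • x) :
    ∀ x : A, (n * p) • x = 0 → g ^ p • x = d ^ p • x := by
  intro x hx
  -- the error term `E x = g • x - d • x` is killed by `p`, hence by `n`, so `g E x = d E x`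
  have hpx : n • (p • x) = 0 := by rw [← mul_nsmul']; exact hx
  have hEp : p • (g • x - d • x) = 0 := by
    rw [smul_sub, smul_comm p g x, smul_comm p d x, hg _ hpx, sub_self]
  have hEn : n • (g • x - d • x) = 0 := by
    obtain ⟨k, rfl⟩ := hn
    rw [mul_comm, mul_nsmul', hEp, nsmul_zero]
  have hgE : g • (g • x - d • x) = d • (g • x - d • x) := hg _ hEn
  -- `g^{j+1} x = d^{j+1} x + (j+1) (d^j E x)`
  set y : A := g • x - d • x with hy_def
  have hy : g • x = d • x + y := by rw [hy_def]; abel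
  clear_value y
  have key : ∀ j : ℕ, g ^ (j + 1) • x = d ^ (j + 1) • x + ((j + 1 : ℕ) : ℤ) • (d ^ j • y) := by
    intro j
    induction j with
    | zero => simp only [zero_add, pow_one, Nat.cast_one, one_smul, pow_zero, hy]
    | succ j ih =>
      rw [pow_succ', mul_smul, ih, smul_add, smul_comm g (((j + 1 : ℕ) : ℤ)) (d ^ j • y),
        smul_comm g (d ^ j) y, hgE, smul_comm g (d ^ (j + 1)) x, hy]
      simp only [smul_add, smul_smul, Nat.cast_add, Nat.cast_one]
      module
  rcases Nat.eq_zero_or_pos p with hp | hp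
  · subst hp
    simp
  · obtain ⟨q, hq⟩ : ∃ q, p = q + 1 := ⟨p - 1, by omega⟩
    rw [hq, key q, ← hq]
    have h0 : ((p : ℕ) : ℤ) • (d ^ q • y) = 0 := by
      rw [natCast_zsmul, smul_comm, hEp, smul_zero]
    rw [h0, add_zero]

/-- **The lift.** If `g` acts as the integer scalar `d` on `A[p]`, then for every `k ≥ 1`,
`g^{p^{k-1}}` acts as `d^{p^{k-1}}` on `A[p^k]`. [folklore] -/
theorem smul_pow_eq_of_smul_eq {p : ℕ} {g : G} {d : ℤ} (hg : ∀ x : A, p • x = 0 → g • x = d • x)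
    {k : ℕ} (hk : 1 ≤ k) :
    ∀ x : A, (p ^ k) • x = 0 → g ^ (p ^ (k - 1)) • x = d ^ (p ^ (k - 1)) • x := by
  induction k, hk using Nat.le_induction with
  | base => simpa using hg
  | succ k hk ih =>
    intro x hx
    have hdiv : p ∣ p ^ k := dvd_pow_self p (by omega)
    have h := smul_pow_eq_of_smul_eq_step hdiv ih x (by rw [← pow_succ]; exact hx)
    rw [← pow_mul, ← pow_mul, ← pow_succ, show k - 1 + 1 = k + 1 - 1 by omega] at h
    exact h

end Lift

/-! ## §2 A homothety `≢ 1 (mod p)` forces `H¹(K(E[n])/K, E[n]) = 0` and `E[n]^{Γ_K} = 0` -/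

section Sah

variable {K : Type u} [Field K] (V : WeierstrassCurve K) [V.IsElliptic]

omit [V.IsElliptic] in
/-- On `E[n]`, multiplication by an integer prime to `n`... more precisely: if `(d - 1)` is prime to
`n` then `(d - 1) • P = 0` forces `P = 0` for `P ∈ E[n]` (Bézout). [folklore] -/
theorem eq_zero_of_sub_one_smul_eq_zero {n : ℕ} {d : ℤ} (hd : IsCoprime (d - 1) (n : ℤ))
    (P : geomTorsion V (n : ℤ)) (hP : (d - 1) • P = 0) : P = 0 := by
  obtain ⟨a, b, hab⟩ := hd
  have hn : (n : ℤ) • P = 0 := by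
    rw [natCast_zsmul]
    exact AddSubgroup.torsionBy.nsmul P
  calc P = (1 : ℤ) • P := (one_smul ℤ P).symm
    _ = (a * (d - 1) + b * n) • P := by rw [hab]
    _ = 0 := by rw [add_smul, mul_smul, mul_smul, hP, hn, smul_zero, smul_zero, add_zero]

/-- If `g₀ ∈ Γ_K` acts on `E[n]` as an integer scalar `d` with `d - 1` prime to `n`, then
`P ↦ g₀ P - P` is a bijection of `E[n]`. [folklore] -/
theorem bijective_smul_sub_of_smul_eq {n : ℕ} (hn : n ≠ 0) {g₀ : absoluteGaloisGroup K} {d : ℤ}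
    (hg : ∀ P : geomTorsion V (n : ℤ), g₀ • P = d • P) (hd : IsCoprime (d - 1) (n : ℤ)) :
    Function.Bijective fun P : geomTorsion V (n : ℤ) => g₀ • P - P := by
  haveI : Finite (geomTorsion V (n : ℤ)) :=
    finite_torsionPoints_holds V (AlgebraicClosure K) (by exact_mod_cast hn)
  refine Finite.injective_iff_bijective.mp fun P Q hPQ => ?_
  have hPQ' : g₀ • P - P = g₀ • Q - Q := hPQ
  rw [hg, hg] at hPQ'
  have h : (d - 1) • (P - Q) = 0 := by
    rw [smul_sub, sub_smul, sub_smul, one_smul, one_smul, hPQ', sub_self]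
  exact sub_eq_zero.mp (eq_zero_of_sub_one_smul_eq_zero V hd _ h)

/-- **Restriction to `K(E[n])` is injective** — `ker (H¹(K, E[n]) → H¹(K(E[n]), E[n])) = 0` — as
soon as some `g₀ ∈ Γ_K` acts on `E[n]` as an integer scalar `d` with `d - 1` prime to `n`: such a
`g₀` is central modulo `Γ_{K(E[n])}` (it commutes with every additive map of `E[n]`) and `g₀ - 1`
is bijective on `E[n]`, so Sah's lemma in the tree's form `Rubin1987.subgroupResKer_eq_bot_of_bijOn`
applies. This is the mechanism of Grigorov–Jorza–Patrikis–Stein–Tarniţă, Prop. 5.4 (a non-trivial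
homothety in the image kills `H¹(K(E[p^M])/K, E[p^M])`), with no image hypothesis beyond the
homothety. [cite: GrigorovJorzaPatrikisSteinTarnita2009, Prop. 5.2 and Prop. 5.4]
[cite: Rubin1999, Lemma 6.2 (i)] -/
theorem subgroupResKer_torsionFixing_eq_bot_of_smul_eq {n : ℕ} (hn : n ≠ 0)
    {g₀ : absoluteGaloisGroup K} {d : ℤ} (hg : ∀ P : geomTorsion V (n : ℤ), g₀ • P = d • P)
    (hd : IsCoprime (d - 1) (n : ℤ)) :
    subgroupResKer (geomTorsion V (n : ℤ)) (torsionFixing V (n : ℤ)) = ⊥ := by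
  have hs : {P : geomTorsion V (n : ℤ) | ∀ m ∈ torsionFixing V (n : ℤ), m • P = P} = Set.univ :=
    Set.eq_univ_of_forall fun P m hm => smul_eq_of_mem_torsionFixing V (n : ℤ) hm P
  refine Rubin1987.subgroupResKer_eq_bot_of_bijOn (torsionFixing V (n : ℤ))
    (isOpen_torsionFixing V (by exact_mod_cast hn)) (g₀ := g₀) (fun g => ?_) ?_
  · -- `g₀` is central modulo `Γ_{K(E[n])}`
    refine ⟨(g * g₀)⁻¹ * (g₀ * g), (mem_torsionFixing_iff V (n : ℤ)).mpr fun P => ?_, by group⟩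
    have hcomm : (g₀ * g) • P = (g * g₀) • P := by
      rw [mul_smul, mul_smul, hg, hg, smul_comm]
    rw [mul_smul, hcomm, inv_smul_smul]
  · rw [hs]
    exact Set.bijOn_univ.mpr (bijective_smul_sub_of_smul_eq V hn hg hd)

omit [V.IsElliptic] in
/-- **No fixed points**: under the same hypothesis, `E[n]^{Γ_K} = 0` — a `Γ_K`-fixed `P ∈ E[n]`
has `(d - 1) P = g₀ P - P = 0`, so `P = 0`. (GJPST's `p ∤ #E(K)_tors` at the level `n = p^M`.)
[cite: GrigorovJorzaPatrikisSteinTarnita2009, Prop. 5.2] -/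
theorem eq_zero_of_forall_smul_eq_of_smul_eq {n : ℕ} {g₀ : absoluteGaloisGroup K} {d : ℤ}
    (hg : ∀ P : geomTorsion V (n : ℤ), g₀ • P = d • P) (hd : IsCoprime (d - 1) (n : ℤ))
    (P : geomTorsion V (n : ℤ)) (hP : g₀ • P = P) : P = 0 := by
  refine eq_zero_of_sub_one_smul_eq_zero V hd P ?_
  rw [sub_smul, one_smul, ← hg, hP, sub_self]

end Sah

/-! ## §3 Two-by-two matrices: the commutant of a non-scalar matrix, and the norm of a conjugate -/

section Matrices

variable {F : Type*} [Field F]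

/-- **The centraliser of a NON-SCALAR `2 × 2` matrix over a field is `F + F·A`** (the version of
the tree's `DeuringLadic.Matrix.exists_eq_smul_one_add_smul_of_commute` without the separability
hypothesis `tr² ≠ 4 det`, so that it applies to a non-zero NILPOTENT `A`). [folklore] -/
theorem exists_eq_smul_one_add_smul_of_commute_of_ne {A M : Matrix (Fin 2) (Fin 2) F}
    (hA : ∀ a : F, A ≠ a • (1 : Matrix (Fin 2) (Fin 2) F)) (hAM : M * A = A * M) :
    ∃ u v : F, M = u • (1 : Matrix (Fin 2) (Fin 2) F) + v • A := by
  obtain ⟨p, q, r, s, rfl⟩ : ∃ p q r s : F, A = !![p, q; r, s] :=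
    ⟨A 0 0, A 0 1, A 1 0, A 1 1, Matrix.eta_fin_two A⟩
  obtain ⟨e, f, g, h, rfl⟩ : ∃ e f g h : F, M = !![e, f; g, h] :=
    ⟨M 0 0, M 0 1, M 1 0, M 1 1, Matrix.eta_fin_two M⟩
  rw [Matrix.mul_fin_two, Matrix.mul_fin_two] at hAM
  have a11 := congrFun (congrFun hAM 0) 0
  have a12 := congrFun (congrFun hAM 0) 1
  have a21 := congrFun (congrFun hAM 1) 0
  simp only [Matrix.of_apply, Matrix.cons_val', Matrix.cons_val_zero, Matrix.cons_val_one,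
    Matrix.cons_val_fin_one, Matrix.empty_val'] at a11 a12 a21
  have E1 : f * r = q * g := by linear_combination a11
  have E2 : q * (e - h) = f * (p - s) := by linear_combination a12
  have E3 : g * (p - s) = r * (e - h) := by linear_combination a21
  have key : ∀ u v : F, e = u + v * p → f = v * q → g = v * r → h = u + v * s →
      !![e, f; g, h] = u • (1 : Matrix (Fin 2) (Fin 2) F) + v • !![p, q; r, s] := by
    intro u v he hf hg hh
    rw [Matrix.one_fin_two, Matrix.smul_of, Matrix.smul_of]
    ext i j
    fin_cases i <;> fin_cases j <;> simp [he, hf, hg, hh]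
  by_cases hq : q = 0
  · by_cases hr : r = 0
    · -- `A` diagonal; `p ≠ s` since `A` is not scalar
      subst hq hr
      have hps : p - s ≠ 0 := by
        intro h0
        have hps : p = s := by linear_combination h0
        subst hps
        refine hA p ?_
        rw [Matrix.one_fin_two, Matrix.smul_of]
        ext i j
        fin_cases i <;> fin_cases j <;> simp
      have hf : f = 0 := by
        have : f * (p - s) = 0 := by linear_combination -E2
        exact (mul_eq_zero.mp this).resolve_right hps
      have hg : g = 0 := by
        have : g * (p - s) = 0 := by linear_combination E3
        exact (mul_eq_zero.mp this).resolve_right hps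
      refine ⟨e - (e - h) / (p - s) * p, (e - h) / (p - s), key _ _ (by ring) (by simp [hf])
        (by simp [hg]) ?_⟩
      field_simp
      ring
    · refine ⟨e - g / r * p, g / r, key _ _ (by ring) ?_ ?_ ?_⟩
      · field_simp
        linear_combination E1
      · field_simp
      · field_simp
        linear_combination E3
  · refine ⟨e - f / q * p, f / q, key _ _ (by ring) ?_ ?_ ?_⟩
    · field_simp
    · field_simp
      linear_combination -E1
    · field_simp
      linear_combination -E2

/-- A non-zero `2 × 2` matrix with `A² = 0` is not scalar. [folklore] -/
theorem ne_smul_one_of_mul_self_eq_zero {A : Matrix (Fin 2) (Fin 2) F} (hA0 : A ≠ 0)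
    (hAA : A * A = 0) (a : F) : A ≠ a • (1 : Matrix (Fin 2) (Fin 2) F) := by
  rintro rfl
  have h : (a * a) • (1 : Matrix (Fin 2) (Fin 2) F) = 0 := by
    rw [← hAA, Matrix.smul_mul, Matrix.mul_smul, Matrix.one_mul, smul_smul]
  have ha : a * a = 0 := by
    have h00 := congrFun (congrFun h 0) 0
    simpa using h00
  rcases mul_self_eq_zero.mp ha with rfl
  exact hA0 (zero_smul _ _)

/-- A non-zero `2 × 2` matrix with `A² = 0` has trace `0` and determinant `0` (Cayley–Hamilton
`A² = tr A · A − det A`). [folklore] -/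
theorem trace_eq_zero_and_det_eq_zero_of_mul_self_eq_zero {A : Matrix (Fin 2) (Fin 2) F}
    (hA0 : A ≠ 0) (hAA : A * A = 0) : A.trace = 0 ∧ A.det = 0 := by
  have hCH := DeuringLadic.Matrix.sq_eq_trace_smul_sub_det_fin_two A
  rw [hAA] at hCH
  have htr : A.trace = 0 := by
    by_contra htr
    refine ne_smul_one_of_mul_self_eq_zero hA0 hAA (A.det / A.trace) ?_
    have h1 : A.trace • A = A.det • (1 : Matrix (Fin 2) (Fin 2) F) := by
      rw [eq_comm, sub_eq_zero] at hCH
      exact hCH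
    calc A = (A.trace⁻¹ * A.trace) • A := by rw [inv_mul_cancel₀ htr, one_smul]
      _ = A.trace⁻¹ • (A.det • (1 : Matrix (Fin 2) (Fin 2) F)) := by rw [← smul_smul, h1]
      _ = (A.det / A.trace) • (1 : Matrix (Fin 2) (Fin 2) F) := by
        rw [smul_smul, div_eq_inv_mul]
  refine ⟨htr, ?_⟩
  rw [htr, zero_smul, zero_sub] at hCH
  have h1 : A.det • (1 : Matrix (Fin 2) (Fin 2) F) = 0 := neg_eq_zero.mp hCH.symm
  have h00 := congrFun (congrFun h1 0) 0
  simpa using h00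

/-- `det (u + v A) = u² + u v · tr A + v² · det A` for a `2 × 2` matrix `A`. [folklore] -/
theorem det_smul_one_add_smul {R : Type*} [CommRing R] (A : Matrix (Fin 2) (Fin 2) R) (u v : R) :
    (u • (1 : Matrix (Fin 2) (Fin 2) R) + v • A).det = u ^ 2 + u * v * A.trace + v ^ 2 * A.det := by
  obtain ⟨a, b, c, d, rfl⟩ : ∃ a b c d : R, A = !![a, b; c, d] :=
    ⟨A 0 0, A 0 1, A 1 0, A 1 1, Matrix.eta_fin_two A⟩
  rw [Matrix.trace_fin_two_of, Matrix.det_fin_two_of, Matrix.one_fin_two, Matrix.smul_of,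
    Matrix.smul_of]
  simp only [Matrix.of_add_of]
  simp
  ring

/-- **The norm of a conjugate is the determinant.** Let `A ≠ 0` with `A² = 0`, let `B` commute
with `A` and let `C` anti-commute with `A` (`C A = −A C`), `C C' = 1`. Then
`B · (C B C') = det B · 1`: indeed `B = u + vA`, `C B C' = u − vA`, and the product is
`u² − v² A² = u² = det B`. (For the mod-`p` representation of a CM curve at a ramified `p`:
`A = √−p`, `B` the image of an element fixing `√−p`, `C` of one negating it.) [folklore] -/
theorem mul_conj_eq_det_smul_one {A B C C' : Matrix (Fin 2) (Fin 2) F} (hA0 : A ≠ 0)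
    (hAA : A * A = 0) (hBA : B * A = A * B) (hCA : C * A = -(A * C)) (hCC' : C * C' = 1) :
    B * (C * B * C') = B.det • (1 : Matrix (Fin 2) (Fin 2) F) := by
  obtain ⟨u, v, rfl⟩ :=
    exists_eq_smul_one_add_smul_of_commute_of_ne (ne_smul_one_of_mul_self_eq_zero hA0 hAA) hBA
  obtain ⟨htr, hdet⟩ := trace_eq_zero_and_det_eq_zero_of_mul_self_eq_zero hA0 hAA
  have hconj : C * (u • (1 : Matrix (Fin 2) (Fin 2) F) + v • A) * C' =
      u • (1 : Matrix (Fin 2) (Fin 2) F) - v • A := by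
    rw [Matrix.mul_add, Matrix.add_mul, Matrix.mul_smul, Matrix.mul_one, Matrix.smul_mul, hCC',
      Matrix.mul_smul, Matrix.smul_mul, hCA, Matrix.neg_mul, Matrix.mul_assoc, hCC',
      Matrix.mul_one, smul_neg, sub_eq_add_neg]
  rw [hconj, det_smul_one_add_smul, htr, hdet]
  have hexp : (u • (1 : Matrix (Fin 2) (Fin 2) F) + v • A) * (u • (1 : Matrix (Fin 2) (Fin 2) F) - v • A) =
      (u * u) • (1 : Matrix (Fin 2) (Fin 2) F) - (v * v) • (A * A) := by
    simp only [Matrix.add_mul, Matrix.mul_sub, Matrix.smul_mul, Matrix.mul_smul, Matrix.one_mul,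
      Matrix.mul_one]
    module
  rw [hexp, hAA, smul_zero, sub_zero]
  congr 1
  ring

end Matrices

end Summit.BirchSwinnertonDyer.BirchSwinnertonDyer.Theorems.PrintCFram.BorelHomothety

end
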